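import Mathlib.RingTheory.IsTensorProduct
import Mathlib.LinearAlgebra.Basis.VectorSpace
import Mathlib.LinearAlgebra.DirectSum.Finsupp

/-!
# Route LinearSystemTorelli — crux `LocalTubeSpan` (stmt-HodgeConjecture-2490): coordinates of a base change

Helper file (`--supports stmt-HodgeConjecture-2490`, line `Sketch` of the crux chain, cycle 4
"portability of cyclic detection", stub `stub_baseChangeCoordinates`).  The line's injectivity
theorems for Schnell's third map `H¹(G, V) → ∏_g V/(g - 1)V` are over `ℚ`; the tree's
hyperplane-section local systems are over `ℂ` with a fibrewise `ℚ`-structure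
(`ofRatClassBaseChangeEquiv : ℂ ⊗_ℚ Hᵏ(X; ℚ) ≃ Hᵏ(X; ℂ)`).  To move detection UP along an
extension of scalars one decomposes a `K`-cocycle along a `k`-basis of `K`; this file supplies the
pure linear algebra of that decomposition, stated for an arbitrary base change in Mathlib's sense
(`IsBaseChange K i` for a `k`-linear `i : V → V'`, i.e. `K ⊗_k V ≃ V'`, `c ⊗ x ↦ c • i x`):

* `localTubeSpan_exists_coordinates_of_isBaseChange` — there are scalars `b_j ∈ K` (a `k`-basis
  of `K`) and `k`-linear coordinates `π_j : V' → V` such that every `x'` has finitely many non-zero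
  coordinates, `x' = Σ_{j ∈ T} b_j • i (π_j x')` for every finite `T` carrying them, and the `π_j`
  are NATURAL for every compatible pair (`f : V → V` `k`-linear, `f' : V' → V'` `K`-linear with
  `i ∘ f = f' ∘ i` ⇒ `π_j ∘ f' = f ∘ π_j`).  With `f = ρ(g)`, `f' = ρ'(g)` (an equivariant base
  change of representations) the `π_j` are `G`-equivariant coordinates.

Construction: `π_j = (j-th coefficient) ∘ Θ ∘ e⁻¹` for the equivalence `e : K ⊗_k V ≃ V'` of the
base change and `Θ : K ⊗_k V ≃ (J →₀ k) ⊗_k V ≃ (J →₀ V)` (`Basis.repr`, Mathlib's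
`TensorProduct.finsuppScalarLeft`); a compatible `f'` is `e ∘ (id ⊗ f) ∘ e⁻¹`, and `Θ` carries
`id ⊗ f` to `Finsupp.mapRange f`.  Pure linear algebra over Mathlib; no named facts.
-/

-- `Summit.HodgeConjecture.HodgeConjecture.Theorems` is the mandated namespace (single-conjunct summit:
-- Sub = Summit), which `linter.dupNamespace` flags on every declaration; the lakefile turns the
-- linter off tree-wide (weak option), restated here so stand-alone elaboration is warning-free too.
set_option linter.dupNamespace false

noncomputable section

open scoped TensorProduct

namespace Summit.HodgeConjecture.HodgeConjecture.Theorems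

universe u v w

section Coordinates

variable {k K : Type u} [Field k] [CommRing K] [Algebra k K]
  {V : Type v} [AddCommGroup V] [Module k V]
  {V' : Type w} [AddCommGroup V'] [Module k V'] [Module K V'] [IsScalarTower k K V']

/-- A `K`-linear map `f'` compatible with the `k`-linear `f` along a base change `i`
(`i ∘ f = f' ∘ i`) is, through the equivalence `e : K ⊗_k V ≃ V'`, the base change `id ⊗ f`:
`e⁻¹ (f' x') = (id ⊗ f) (e⁻¹ x')`. [folklore] -/
theorem localTubeSpan_isBaseChange_equiv_symm_apply_of_comm (i : V →ₗ[k] V') (hi : IsBaseChange K i)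
    (f : V →ₗ[k] V) (f' : V' →ₗ[K] V') (hff' : ∀ x : V, i (f x) = f' (i x)) (x' : V') :
    hi.equiv.symm (f' x') = f.baseChange K (hi.equiv.symm x') := by
  -- `f' ∘ e = e ∘ (id ⊗ f)` on all tensors, by linearity from pure tensors
  have key : ∀ t : K ⊗[k] V, f' (hi.equiv t) = hi.equiv (f.baseChange K t) := by
    intro t
    induction t using TensorProduct.induction_on with
    | zero => simp only [map_zero]
    | tmul c x =>
        rw [LinearMap.baseChange_tmul, IsBaseChange.equiv_tmul, IsBaseChange.equiv_tmul,
          map_smul, hff']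
    | add t₁ t₂ h₁ h₂ => simp only [map_add, h₁, h₂]
  apply hi.equiv.injective
  rw [LinearEquiv.apply_symm_apply, ← key, LinearEquiv.apply_symm_apply]

/-- **Coordinates of a base change.**  For a field `k`, a commutative `k`-algebra `K` and a base
change `i : V → V'` (`IsBaseChange K i`) there are scalars `b_j ∈ K` and `k`-linear coordinates
`π_j : V' → V` (`j ∈ J`) such that: every `x'` has finitely many non-zero coordinates;
`x' = Σ_{j ∈ T} b_j • i (π_j x')` for every finite `T` outside which the coordinates of `x'`
vanish; and the `π_j` are natural for every compatible pair `(f, f')` (`i ∘ f = f' ∘ i` ⇒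
`π_j ∘ f' = f ∘ π_j`).  (`b` a `k`-basis of `K`, `π_j = b_j^* ⊗ id` through `K ⊗_k V ≃ V'`.)
[folklore] -/
theorem localTubeSpan_exists_coordinates_of_isBaseChange (i : V →ₗ[k] V') (hi : IsBaseChange K i) :
    ∃ (J : Type u) (b : J → K) (π : J → (V' →ₗ[k] V)),
      (∀ x' : V', (Function.support fun j => π j x').Finite) ∧
      (∀ (x' : V') (T : Finset J), (∀ j ∉ T, π j x' = 0) →
        x' = ∑ j ∈ T, b j • i (π j x')) ∧
      ∀ (f : V →ₗ[k] V) (f' : V' →ₗ[K] V'), (∀ x : V, i (f x) = f' (i x)) →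
        ∀ (j : J) (x' : V'), π j (f' x') = f (π j x') := by
  classical
  -- a `k`-basis of `K` and the coordinate equivalence `Θ : K ⊗_k V ≃ (J →₀ V)`
  let J : Type u := Module.Basis.ofVectorSpaceIndex k K
  let bK : Module.Basis J k K := Module.Basis.ofVectorSpace k K
  let Θ : K ⊗[k] V ≃ₗ[k] (J →₀ V) :=
    TensorProduct.congr bK.repr (LinearEquiv.refl k V) ≪≫ₗ TensorProduct.finsuppScalarLeft k V J
  have hΘ_tmul : ∀ (c : K) (x : V) (j : J), Θ (c ⊗ₜ x) j = bK.repr c j • x := fun c x j => by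
    simp only [Θ, LinearEquiv.trans_apply, TensorProduct.congr_tmul, LinearEquiv.refl_apply,
      TensorProduct.finsuppScalarLeft_apply_tmul_apply]
  have hΘ_symm_single : ∀ (j : J) (x : V), Θ.symm (Finsupp.single j x) = bK j ⊗ₜ x :=
    fun j x => by
      simp only [Θ, LinearEquiv.trans_symm, LinearEquiv.trans_apply,
        TensorProduct.finsuppScalarLeft_symm_apply_single, TensorProduct.congr_symm_tmul,
        LinearEquiv.refl_symm, LinearEquiv.refl_apply, Module.Basis.repr_symm_single_one]
  -- the equivalence of the base change, as a `k`-linear equivalence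
  let e : K ⊗[k] V ≃ₗ[K] V' := hi.equiv
  let ek : K ⊗[k] V ≃ₗ[k] V' := e.restrictScalars k
  -- the coordinates
  let π : J → (V' →ₗ[k] V) := fun j => Finsupp.lapply j ∘ₗ Θ.toLinearMap ∘ₗ ek.symm.toLinearMap
  have hπ : ∀ (j : J) (x' : V'), π j x' = Θ (e.symm x') j := fun j x' => rfl
  refine ⟨J, bK, π, fun x' => ?_, fun x' T hT => ?_, fun f f' hff' j x' => ?_⟩
  · -- finitely many non-zero coordinates: the support of a finitely supported function
    refine (Θ (e.symm x')).support.finite_toSet.subset fun j hj => ?_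
    rw [Function.mem_support, hπ] at hj
    exact Finset.mem_coe.2 (Finsupp.mem_support_iff.2 hj)
  · -- reconstruction: `x' = Σ_{j ∈ T} b_j • i (π_j x')`
    set F : J →₀ V := Θ (e.symm x') with hFdef
    have hsupp : F.support ⊆ T := fun j hj => by
      by_contra hjT
      exact (Finsupp.mem_support_iff.1 hj) (by rw [hFdef, ← hπ]; exact hT j hjT)
    have hF : F = ∑ j ∈ T, Finsupp.single j (F j) := by
      conv_lhs => rw [← Finsupp.sum_single F]
      exact Finsupp.sum_of_support_subset F hsupp (fun j v => Finsupp.single j v)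
        (fun j _ => Finsupp.single_zero j)
    have hx' : x' = e (Θ.symm F) := by
      rw [hFdef, LinearEquiv.symm_apply_apply, LinearEquiv.apply_symm_apply]
    calc x' = e (Θ.symm F) := hx'
      _ = e (Θ.symm (∑ j ∈ T, Finsupp.single j (F j))) := by rw [← hF]
      _ = ∑ j ∈ T, e (Θ.symm (Finsupp.single j (F j))) := by rw [map_sum, map_sum]
      _ = ∑ j ∈ T, bK j • i (π j x') := by
          refine Finset.sum_congr rfl fun j _ => ?_
          rw [hΘ_symm_single, IsBaseChange.equiv_tmul, hπ]
  · -- naturality: `π_j (f' x') = f (π_j x')`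
    have hnat : ∀ t : K ⊗[k] V, Θ (f.baseChange K t) j = f (Θ t j) := by
      intro t
      induction t using TensorProduct.induction_on with
      | zero => simp only [map_zero, Finsupp.coe_zero, Pi.zero_apply]
      | tmul c x => rw [LinearMap.baseChange_tmul, hΘ_tmul, hΘ_tmul, map_smul]
      | add t₁ t₂ h₁ h₂ => simp only [map_add, Finsupp.coe_add, Pi.add_apply, h₁, h₂]
    rw [hπ, hπ, localTubeSpan_isBaseChange_equiv_symm_apply_of_comm i hi f f' hff', hnat]

end Coordinates

end Summit.HodgeConjecture.HodgeConjecture.Theorems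

end
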